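import Summits.BirchSwinnertonDyer.BirchSwinnertonDyer.Theorems.EisensteinPrimesMazurMCOnCellBTwistbackUnitEndP5Cell395c1
import Summits.BirchSwinnertonDyer.BirchSwinnertonDyer.Theorems.EisensteinPrimesMazurMCOnCellBTwistbackUnitEndP5Cell110a1
import Summits.BirchSwinnertonDyer.BirchSwinnertonDyer.Theorems.EisensteinPrimesMazurMCOnCellBTwistbackUnitEndP5Cell1310c1
import Summits.BirchSwinnertonDyer.BirchSwinnertonDyer.Theorems.EisensteinPrimesMazurMCOnCellBTwistbackUnitEndP5Cell2090n1
import Summits.BirchSwinnertonDyer.BirchSwinnertonDyer.Theorems.EisensteinPrimesMazurMCOnCellBTwistbackUnitEndP5Cell2715c1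
import Summits.BirchSwinnertonDyer.BirchSwinnertonDyer.Theorems.EisensteinPrimesMazurMCOnCellBOfNamedFactsV9
import Summits.BirchSwinnertonDyer.BirchSwinnertonDyer.Theorems.EisensteinPrimesMazurMCOnCellBTwistbackDefectSwapUp
import HarnessLib

/-!
# Crux 3 `MazurMCOnCellB` (stmt-BirchSwinnertonDyer-19033), line `twistback` v12 — DISTANCE-0 DISPLAYS at `p = 5` and `p = 7`:
# the X2b classes displayed by this seat at `p ≠ 3` are THEMSELVES Ш-unit vertices, so Mazur's main conjecture and `BSD(E,p)`
# at their base members follow from PUBLISHED inputs only (`PublishedInputs` + Wuthrich 2014 Prop. 21) and TWO Cremona readings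

Width seat bsd-line-x2-p1-w5 (g5), cell `bsd-eis` (run/shared/lean/pub/bsd-eis/), 2026-08-29; `--supports stmt-BirchSwinnertonDyer-19033
--as helper`. THEOREMS ONLY (no `def`, no named fact, no `sorry`, no instance). WHY (lam-a g18 04:43:32Z, kit CHK column; this
seat's BSD self-checks): unlike the `p = 3` atlas A10 — where `#Ш_an = 9` at EVERY member of all 127 classes, so a Ш-unit vertex is
two admissible twists away — every screened X2b class at `p = 5` (225/225) and `p = 7` (10/10) has a member with `v_p(#Ш_an) = 0`
(Cremona). For such a class the registered stub 6⁷'s LEFT disjunct holds at distance 0 (`Relation.ReflTransGen.refl`, no field, no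
twist), and the tree's PUBLISHED-inputs-only doors apply: LEAD g14's `…OfNamedFactsV9.mazurMainConjectureAt_of_namedFacts_of_classShaUnit`
(Wuthrich Prop. 21 + GZK ⇒ `BSDp`, Cassels, `X2.mazurMainConjectureAt_of_bsdp_of_red`) and w3 g14's
`…DefectSwapUp.bsdp_of_cellB_of_classShaUnit`. So the two-step files of this seat (p691901 … p697238, and the `p = 7` pair
p694064/p695701) ILLUSTRATE the distance-2 machinery at `p ≠ 3`; the per-pair STATUS of these cells is better than that: this file
records it — cone = {`PublishedInputs` (item 19037, PUB), Wuthrich 2014 Prop. 21 (PUB)}, readings = `hr` (`r_an = 0`) and `hunit`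
(`#Ш_an` of the base member a `p`-adic unit; Cremona `allbsd`: `#Ш_an = 1` for every curve below). The kernel input per cell is the
`X2.CellB` theorem of the cited display file (split multiplicative at `p`, rational point of order `p`, `E[p]` reducible, `¬ GVPar`).

PER CELL (ns `…<cell file>`): `cellB_<E>_of_analyticRank` from
* `395c1 = [0, -1, 1, -50, 156]` at `p = 5` — `…backUnitEndP5Cell395c1` (p691901); Cremona: `#T = 5`, `∏c = 5`, `Ω = 3.12497731`, `L(E,1) = 0.62499546`, `#Ш_an = 1`;
* `110a1 = [1, 1, 1, 10, -45]` at `p = 5` — `…backUnitEndP5Cell110a1` (p693972); Cremona: `#T = 5`, `∏c = 25`, `Ω = 1.35954181`, `L(E,1) = 1.35954181`, `#Ш_an = 1`;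
* `1310c1 = [1, 1, 1, -95, 357]` at `p = 5` — `…ackUnitEndP5Cell1310c1` (p695646); Cremona: `#T = 5`, `∏c = 25`, `Ω = 2.16941548`, `L(E,1) = 2.16941548`, `#Ш_an = 1`;
* `2090n1 = [1, 1, 1, -485, 3915]` at `p = 5` — `…ackUnitEndP5Cell2090n1` (p695929); Cremona: `#T = 5`, `∏c = 25`, `Ω = 2.15518557`, `L(E,1) = 2.15518557`, `#Ш_an = 1`;
* `2715c1 = [0, 1, 1, -140, 806]` at `p = 5` — `…ackUnitEndP5Cell2715c1` (p695762); Cremona: `#T = 5`, `∏c = 25`, `Ω = 1.72276310`, `L(E,1) = 1.72276310`, `#Ш_an = 1`;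
HONEST FRAMING: conditional per-pair theorems; readings are NOT theorems (`analyticRank = 0` and `#Ш_an` unit are Cremona's numerics);
nothing is booked; Mazur's main conjecture / BSD is proved for NO curve unconditionally; no summit statement is proved; closes no
registered stub (6⁷ is the class-wide supply statement); 0 cells / labels / stubs / tiers move. References: [Wuthrich2014] Prop. 21,
Thm. 16; [SteinWuthrich2013] Thm. 6.1; [GreenbergLNM1716] §4–5; [MilneADT2006] I.7.3; [Miller2011LMS] Def. 1.1; Cremona allbsd.
-/
set_option autoImplicit false
-- `Summit.BirchSwinnertonDyer.BirchSwinnertonDyer.…`: the summit and its single sub-problem share a name.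
set_option linter.dupNamespace false
noncomputable section
open scoped Classical
open WeierstrassCurve NumberField Literature.NumberTheory.EllipticCurves Literature.NumberTheory.EllipticCurves.ModularForms
  Literature.NumberTheory.EllipticCurves.Rank1Residual Literature.NumberTheory.EllipticCurves.Rank1Residual.Typed
  Literature.NumberTheory.EllipticCurves.Wuthrich2014 Literature.NumberTheory.GaloisCohomology
  Summit.BirchSwinnertonDyer.Rank1Residual Summit.BirchSwinnertonDyer.Rank1Residual.X2
  Summit.BirchSwinnertonDyer.BirchSwinnertonDyer.Theses Summit.BirchSwinnertonDyer.BirchSwinnertonDyer.Theorems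
  Summit.BirchSwinnertonDyer.BirchSwinnertonDyer.Theorems.EisensteinPrimesMazurMCOnCellBTwistbackTwoStepDefs

namespace Summit.BirchSwinnertonDyer.BirchSwinnertonDyer.Theorems.EisensteinPrimesMazurMCOnCellBTwistbackShaUnitVertexDisplays01

/-! ## `(395c1, 5)` — a Ш-unit vertex (`#Ш_an(395c1) = 1`) -/

/-- **6⁷'s LEFT disjunct at `(395c1, 5)` AT DISTANCE 0** (the registered stub's «connected Ш-unit class» hypothesis VERBATIM):
`W₁ = W₃ = Wc = W`, the trivial zig-zag (`Relation.ReflTransGen.refl`), the identity isogenies, ONE reading `hunit` (`#Ш_an(395c1) = 1`,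
Cremona). Fact-free. [cite: CremonaAlgorithms1997, Table 1] -/
theorem connectedClassShaUnit_395c1_refl
    (W : WeierstrassCurve ℚ) [W.IsElliptic] [W.IsGloballyMinimal]
    (hunit : ∃ q : ℚ, shaAn W = (q : ℂ) ∧ padicValRat 5 q = 0) :
    ∃ (W₁ : WeierstrassCurve ℚ) (_ : W₁.IsElliptic) (_ : W₁.IsGloballyMinimal)
      (W₃ : WeierstrassCurve ℚ) (_ : W₃.IsElliptic) (_ : W₃.IsGloballyMinimal)
      (Wc : WeierstrassCurve ℚ) (_ : Wc.IsElliptic) (_ : Wc.IsGloballyMinimal),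
      IsIsogenous W W₁ ∧
      Relation.ReflTransGen (fun A B : WeierstrassCurve ℚ ↦ TwoStepAt 5 A B ∨
        (TwoStepAt 5 B A ∧ ∃ (_ : B.IsElliptic) (_ : B.IsGloballyMinimal), X2.CellB B 5)) W₁ W₃ ∧
      IsIsogenous W₃ Wc ∧
      ∃ q : ℚ, shaAn Wc = (q : ℂ) ∧ padicValRat 5 q = 0 :=
  ⟨W, inferInstance, inferInstance, W, inferInstance, inferInstance, W, inferInstance, inferInstance,
    WeierstrassCurve.isIsogenous_self W, Relation.ReflTransGen.refl, WeierstrassCurve.isIsogenous_self W, hunit⟩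

/-- **Mazur's main conjecture at `(395c1, 5)` from PUBLISHED inputs only + two Cremona readings** (`hr`: `r_an = 0`, `L(E,1) = 0.62499546`;
`hunit`: `#Ш_an = 1`, `#T = 5`, `∏c = 5`, `Ω = 3.12497731`): `X2.CellB` in the kernel (p691901's `cellB_395c1_of_analyticRank`), the class's
own unit member (identity isogeny), `…OfNamedFactsV9.mazurMainConjectureAt_of_namedFacts_of_classShaUnit` (Wuthrich Prop. 21 + GZK,
Cassels, `X2.mazurMainConjectureAt_of_bsdp_of_red`). Cone: `PublishedInputs`, `sha_dvd_analyticSha` — both PUBLISHED. CONDITIONAL;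
nothing booked. [cite: Wuthrich2014, Prop. 21 (p. 400) and Thm. 16 (p. 397)] [cite: MilneADT2006, Thm. I.7.3] [cite: Miller2011LMS, Def. 1.1] -/
theorem mazurMainConjectureAt_395c1_at_five_of_shaUnit (hP : EisensteinPrimes.PublishedInputs) (hW21 : sha_dvd_analyticSha)
    (W : WeierstrassCurve ℚ) [W.IsElliptic] [W.IsGloballyMinimal] (hW : W = ⟨0, -1, 1, -50, 156⟩) (hr : W.analyticRank = 0)
    (hunit : ∃ q : ℚ, shaAn W = (q : ℂ) ∧ padicValRat 5 q = 0) : X2.MazurMainConjectureAt W 5 := by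
  subst hW
  exact EisensteinPrimesMazurMCOnCellBOfNamedFactsV9.mazurMainConjectureAt_of_namedFacts_of_classShaUnit hP hW21 _ 5
    (EisensteinPrimesMazurMCOnCellBTwistbackUnitEndP5Cell395c1.cellB_395c1_of_analyticRank hr)
    ⟨_, inferInstance, inferInstance, WeierstrassCurve.isIsogenous_self _, hunit⟩

/-- **`BSD(E, 5)` at `395c1` from PUBLISHED inputs only + the same two readings** (w3 g14's `…DefectSwapUp.bsdp_of_cellB_of_classShaUnit`:
Wuthrich Prop. 21 + GZK at the unit member, Cassels). CONDITIONAL; nothing booked.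
[cite: Wuthrich2014, Prop. 21 (p. 400)] [cite: MilneADT2006, Thm. I.7.3] [cite: Miller2011LMS, Def. 1.1] -/
theorem bsdp_395c1_at_five_of_shaUnit (hP : EisensteinPrimes.PublishedInputs) (hW21 : sha_dvd_analyticSha)
    (W : WeierstrassCurve ℚ) [W.IsElliptic] [W.IsGloballyMinimal] (hW : W = ⟨0, -1, 1, -50, 156⟩) (hr : W.analyticRank = 0)
    (hunit : ∃ q : ℚ, shaAn W = (q : ℂ) ∧ padicValRat 5 q = 0) : BSDp W 5 := by
  subst hW
  exact EisensteinPrimesMazurMCOnCellBTwistbackDefectSwapUp.bsdp_of_cellB_of_classShaUnit hP hW21 _ 5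
    (EisensteinPrimesMazurMCOnCellBTwistbackUnitEndP5Cell395c1.cellB_395c1_of_analyticRank hr) ⟨_, inferInstance, inferInstance, WeierstrassCurve.isIsogenous_self _, hunit⟩

/-! ## `(110a1, 5)` — a Ш-unit vertex (`#Ш_an(110a1) = 1`) -/

/-- **6⁷'s LEFT disjunct at `(110a1, 5)` AT DISTANCE 0** (the registered stub's «connected Ш-unit class» hypothesis VERBATIM):
`W₁ = W₃ = Wc = W`, the trivial zig-zag (`Relation.ReflTransGen.refl`), the identity isogenies, ONE reading `hunit` (`#Ш_an(110a1) = 1`,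
Cremona). Fact-free. [cite: CremonaAlgorithms1997, Table 1] -/
theorem connectedClassShaUnit_110a1_refl
    (W : WeierstrassCurve ℚ) [W.IsElliptic] [W.IsGloballyMinimal]
    (hunit : ∃ q : ℚ, shaAn W = (q : ℂ) ∧ padicValRat 5 q = 0) :
    ∃ (W₁ : WeierstrassCurve ℚ) (_ : W₁.IsElliptic) (_ : W₁.IsGloballyMinimal)
      (W₃ : WeierstrassCurve ℚ) (_ : W₃.IsElliptic) (_ : W₃.IsGloballyMinimal)
      (Wc : WeierstrassCurve ℚ) (_ : Wc.IsElliptic) (_ : Wc.IsGloballyMinimal),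
      IsIsogenous W W₁ ∧
      Relation.ReflTransGen (fun A B : WeierstrassCurve ℚ ↦ TwoStepAt 5 A B ∨
        (TwoStepAt 5 B A ∧ ∃ (_ : B.IsElliptic) (_ : B.IsGloballyMinimal), X2.CellB B 5)) W₁ W₃ ∧
      IsIsogenous W₃ Wc ∧
      ∃ q : ℚ, shaAn Wc = (q : ℂ) ∧ padicValRat 5 q = 0 :=
  ⟨W, inferInstance, inferInstance, W, inferInstance, inferInstance, W, inferInstance, inferInstance,
    WeierstrassCurve.isIsogenous_self W, Relation.ReflTransGen.refl, WeierstrassCurve.isIsogenous_self W, hunit⟩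

/-- **Mazur's main conjecture at `(110a1, 5)` from PUBLISHED inputs only + two Cremona readings** (`hr`: `r_an = 0`, `L(E,1) = 1.35954181`;
`hunit`: `#Ш_an = 1`, `#T = 5`, `∏c = 25`, `Ω = 1.35954181`): `X2.CellB` in the kernel (p693972's `cellB_110a1_of_analyticRank`), the class's
own unit member (identity isogeny), `…OfNamedFactsV9.mazurMainConjectureAt_of_namedFacts_of_classShaUnit` (Wuthrich Prop. 21 + GZK,
Cassels, `X2.mazurMainConjectureAt_of_bsdp_of_red`). Cone: `PublishedInputs`, `sha_dvd_analyticSha` — both PUBLISHED. CONDITIONAL;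
nothing booked. [cite: Wuthrich2014, Prop. 21 (p. 400) and Thm. 16 (p. 397)] [cite: MilneADT2006, Thm. I.7.3] [cite: Miller2011LMS, Def. 1.1] -/
theorem mazurMainConjectureAt_110a1_at_five_of_shaUnit (hP : EisensteinPrimes.PublishedInputs) (hW21 : sha_dvd_analyticSha)
    (W : WeierstrassCurve ℚ) [W.IsElliptic] [W.IsGloballyMinimal] (hW : W = ⟨1, 1, 1, 10, -45⟩) (hr : W.analyticRank = 0)
    (hunit : ∃ q : ℚ, shaAn W = (q : ℂ) ∧ padicValRat 5 q = 0) : X2.MazurMainConjectureAt W 5 := by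
  subst hW
  exact EisensteinPrimesMazurMCOnCellBOfNamedFactsV9.mazurMainConjectureAt_of_namedFacts_of_classShaUnit hP hW21 _ 5
    (EisensteinPrimesMazurMCOnCellBTwistbackUnitEndP5Cell110a1.cellB_110a1_of_analyticRank hr)
    ⟨_, inferInstance, inferInstance, WeierstrassCurve.isIsogenous_self _, hunit⟩

/-- **`BSD(E, 5)` at `110a1` from PUBLISHED inputs only + the same two readings** (w3 g14's `…DefectSwapUp.bsdp_of_cellB_of_classShaUnit`:
Wuthrich Prop. 21 + GZK at the unit member, Cassels). CONDITIONAL; nothing booked.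
[cite: Wuthrich2014, Prop. 21 (p. 400)] [cite: MilneADT2006, Thm. I.7.3] [cite: Miller2011LMS, Def. 1.1] -/
theorem bsdp_110a1_at_five_of_shaUnit (hP : EisensteinPrimes.PublishedInputs) (hW21 : sha_dvd_analyticSha)
    (W : WeierstrassCurve ℚ) [W.IsElliptic] [W.IsGloballyMinimal] (hW : W = ⟨1, 1, 1, 10, -45⟩) (hr : W.analyticRank = 0)
    (hunit : ∃ q : ℚ, shaAn W = (q : ℂ) ∧ padicValRat 5 q = 0) : BSDp W 5 := by
  subst hW
  exact EisensteinPrimesMazurMCOnCellBTwistbackDefectSwapUp.bsdp_of_cellB_of_classShaUnit hP hW21 _ 5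
    (EisensteinPrimesMazurMCOnCellBTwistbackUnitEndP5Cell110a1.cellB_110a1_of_analyticRank hr) ⟨_, inferInstance, inferInstance, WeierstrassCurve.isIsogenous_self _, hunit⟩

/-! ## `(1310c1, 5)` — a Ш-unit vertex (`#Ш_an(1310c1) = 1`) -/

/-- **6⁷'s LEFT disjunct at `(1310c1, 5)` AT DISTANCE 0** (the registered stub's «connected Ш-unit class» hypothesis VERBATIM):
`W₁ = W₃ = Wc = W`, the trivial zig-zag (`Relation.ReflTransGen.refl`), the identity isogenies, ONE reading `hunit` (`#Ш_an(1310c1) = 1`,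
Cremona). Fact-free. [cite: CremonaAlgorithms1997, Table 1] -/
theorem connectedClassShaUnit_1310c1_refl
    (W : WeierstrassCurve ℚ) [W.IsElliptic] [W.IsGloballyMinimal]
    (hunit : ∃ q : ℚ, shaAn W = (q : ℂ) ∧ padicValRat 5 q = 0) :
    ∃ (W₁ : WeierstrassCurve ℚ) (_ : W₁.IsElliptic) (_ : W₁.IsGloballyMinimal)
      (W₃ : WeierstrassCurve ℚ) (_ : W₃.IsElliptic) (_ : W₃.IsGloballyMinimal)
      (Wc : WeierstrassCurve ℚ) (_ : Wc.IsElliptic) (_ : Wc.IsGloballyMinimal),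
      IsIsogenous W W₁ ∧
      Relation.ReflTransGen (fun A B : WeierstrassCurve ℚ ↦ TwoStepAt 5 A B ∨
        (TwoStepAt 5 B A ∧ ∃ (_ : B.IsElliptic) (_ : B.IsGloballyMinimal), X2.CellB B 5)) W₁ W₃ ∧
      IsIsogenous W₃ Wc ∧
      ∃ q : ℚ, shaAn Wc = (q : ℂ) ∧ padicValRat 5 q = 0 :=
  ⟨W, inferInstance, inferInstance, W, inferInstance, inferInstance, W, inferInstance, inferInstance,
    WeierstrassCurve.isIsogenous_self W, Relation.ReflTransGen.refl, WeierstrassCurve.isIsogenous_self W, hunit⟩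

/-- **Mazur's main conjecture at `(1310c1, 5)` from PUBLISHED inputs only + two Cremona readings** (`hr`: `r_an = 0`, `L(E,1) = 2.16941548`;
`hunit`: `#Ш_an = 1`, `#T = 5`, `∏c = 25`, `Ω = 2.16941548`): `X2.CellB` in the kernel (p695646's `cellB_1310c1_of_analyticRank`), the class's
own unit member (identity isogeny), `…OfNamedFactsV9.mazurMainConjectureAt_of_namedFacts_of_classShaUnit` (Wuthrich Prop. 21 + GZK,
Cassels, `X2.mazurMainConjectureAt_of_bsdp_of_red`). Cone: `PublishedInputs`, `sha_dvd_analyticSha` — both PUBLISHED. CONDITIONAL;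
nothing booked. [cite: Wuthrich2014, Prop. 21 (p. 400) and Thm. 16 (p. 397)] [cite: MilneADT2006, Thm. I.7.3] [cite: Miller2011LMS, Def. 1.1] -/
theorem mazurMainConjectureAt_1310c1_at_five_of_shaUnit (hP : EisensteinPrimes.PublishedInputs) (hW21 : sha_dvd_analyticSha)
    (W : WeierstrassCurve ℚ) [W.IsElliptic] [W.IsGloballyMinimal] (hW : W = ⟨1, 1, 1, -95, 357⟩) (hr : W.analyticRank = 0)
    (hunit : ∃ q : ℚ, shaAn W = (q : ℂ) ∧ padicValRat 5 q = 0) : X2.MazurMainConjectureAt W 5 := by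
  subst hW
  exact EisensteinPrimesMazurMCOnCellBOfNamedFactsV9.mazurMainConjectureAt_of_namedFacts_of_classShaUnit hP hW21 _ 5
    (EisensteinPrimesMazurMCOnCellBTwistbackUnitEndP5Cell1310c1.cellB_1310c1_of_analyticRank hr)
    ⟨_, inferInstance, inferInstance, WeierstrassCurve.isIsogenous_self _, hunit⟩

/-- **`BSD(E, 5)` at `1310c1` from PUBLISHED inputs only + the same two readings** (w3 g14's `…DefectSwapUp.bsdp_of_cellB_of_classShaUnit`:
Wuthrich Prop. 21 + GZK at the unit member, Cassels). CONDITIONAL; nothing booked.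
[cite: Wuthrich2014, Prop. 21 (p. 400)] [cite: MilneADT2006, Thm. I.7.3] [cite: Miller2011LMS, Def. 1.1] -/
theorem bsdp_1310c1_at_five_of_shaUnit (hP : EisensteinPrimes.PublishedInputs) (hW21 : sha_dvd_analyticSha)
    (W : WeierstrassCurve ℚ) [W.IsElliptic] [W.IsGloballyMinimal] (hW : W = ⟨1, 1, 1, -95, 357⟩) (hr : W.analyticRank = 0)
    (hunit : ∃ q : ℚ, shaAn W = (q : ℂ) ∧ padicValRat 5 q = 0) : BSDp W 5 := by
  subst hW
  exact EisensteinPrimesMazurMCOnCellBTwistbackDefectSwapUp.bsdp_of_cellB_of_classShaUnit hP hW21 _ 5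
    (EisensteinPrimesMazurMCOnCellBTwistbackUnitEndP5Cell1310c1.cellB_1310c1_of_analyticRank hr) ⟨_, inferInstance, inferInstance, WeierstrassCurve.isIsogenous_self _, hunit⟩

/-! ## `(2090n1, 5)` — a Ш-unit vertex (`#Ш_an(2090n1) = 1`) -/

/-- **6⁷'s LEFT disjunct at `(2090n1, 5)` AT DISTANCE 0** (the registered stub's «connected Ш-unit class» hypothesis VERBATIM):
`W₁ = W₃ = Wc = W`, the trivial zig-zag (`Relation.ReflTransGen.refl`), the identity isogenies, ONE reading `hunit` (`#Ш_an(2090n1) = 1`,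
Cremona). Fact-free. [cite: CremonaAlgorithms1997, Table 1] -/
theorem connectedClassShaUnit_2090n1_refl
    (W : WeierstrassCurve ℚ) [W.IsElliptic] [W.IsGloballyMinimal]
    (hunit : ∃ q : ℚ, shaAn W = (q : ℂ) ∧ padicValRat 5 q = 0) :
    ∃ (W₁ : WeierstrassCurve ℚ) (_ : W₁.IsElliptic) (_ : W₁.IsGloballyMinimal)
      (W₃ : WeierstrassCurve ℚ) (_ : W₃.IsElliptic) (_ : W₃.IsGloballyMinimal)
      (Wc : WeierstrassCurve ℚ) (_ : Wc.IsElliptic) (_ : Wc.IsGloballyMinimal),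
      IsIsogenous W W₁ ∧
      Relation.ReflTransGen (fun A B : WeierstrassCurve ℚ ↦ TwoStepAt 5 A B ∨
        (TwoStepAt 5 B A ∧ ∃ (_ : B.IsElliptic) (_ : B.IsGloballyMinimal), X2.CellB B 5)) W₁ W₃ ∧
      IsIsogenous W₃ Wc ∧
      ∃ q : ℚ, shaAn Wc = (q : ℂ) ∧ padicValRat 5 q = 0 :=
  ⟨W, inferInstance, inferInstance, W, inferInstance, inferInstance, W, inferInstance, inferInstance,
    WeierstrassCurve.isIsogenous_self W, Relation.ReflTransGen.refl, WeierstrassCurve.isIsogenous_self W, hunit⟩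

/-- **Mazur's main conjecture at `(2090n1, 5)` from PUBLISHED inputs only + two Cremona readings** (`hr`: `r_an = 0`, `L(E,1) = 2.15518557`;
`hunit`: `#Ш_an = 1`, `#T = 5`, `∏c = 25`, `Ω = 2.15518557`): `X2.CellB` in the kernel (p695929's `cellB_2090n1_of_analyticRank`), the class's
own unit member (identity isogeny), `…OfNamedFactsV9.mazurMainConjectureAt_of_namedFacts_of_classShaUnit` (Wuthrich Prop. 21 + GZK,
Cassels, `X2.mazurMainConjectureAt_of_bsdp_of_red`). Cone: `PublishedInputs`, `sha_dvd_analyticSha` — both PUBLISHED. CONDITIONAL;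
nothing booked. [cite: Wuthrich2014, Prop. 21 (p. 400) and Thm. 16 (p. 397)] [cite: MilneADT2006, Thm. I.7.3] [cite: Miller2011LMS, Def. 1.1] -/
theorem mazurMainConjectureAt_2090n1_at_five_of_shaUnit (hP : EisensteinPrimes.PublishedInputs) (hW21 : sha_dvd_analyticSha)
    (W : WeierstrassCurve ℚ) [W.IsElliptic] [W.IsGloballyMinimal] (hW : W = ⟨1, 1, 1, -485, 3915⟩) (hr : W.analyticRank = 0)
    (hunit : ∃ q : ℚ, shaAn W = (q : ℂ) ∧ padicValRat 5 q = 0) : X2.MazurMainConjectureAt W 5 := by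
  subst hW
  exact EisensteinPrimesMazurMCOnCellBOfNamedFactsV9.mazurMainConjectureAt_of_namedFacts_of_classShaUnit hP hW21 _ 5
    (EisensteinPrimesMazurMCOnCellBTwistbackUnitEndP5Cell2090n1.cellB_2090n1_of_analyticRank hr)
    ⟨_, inferInstance, inferInstance, WeierstrassCurve.isIsogenous_self _, hunit⟩

/-- **`BSD(E, 5)` at `2090n1` from PUBLISHED inputs only + the same two readings** (w3 g14's `…DefectSwapUp.bsdp_of_cellB_of_classShaUnit`:
Wuthrich Prop. 21 + GZK at the unit member, Cassels). CONDITIONAL; nothing booked.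
[cite: Wuthrich2014, Prop. 21 (p. 400)] [cite: MilneADT2006, Thm. I.7.3] [cite: Miller2011LMS, Def. 1.1] -/
theorem bsdp_2090n1_at_five_of_shaUnit (hP : EisensteinPrimes.PublishedInputs) (hW21 : sha_dvd_analyticSha)
    (W : WeierstrassCurve ℚ) [W.IsElliptic] [W.IsGloballyMinimal] (hW : W = ⟨1, 1, 1, -485, 3915⟩) (hr : W.analyticRank = 0)
    (hunit : ∃ q : ℚ, shaAn W = (q : ℂ) ∧ padicValRat 5 q = 0) : BSDp W 5 := by
  subst hW
  exact EisensteinPrimesMazurMCOnCellBTwistbackDefectSwapUp.bsdp_of_cellB_of_classShaUnit hP hW21 _ 5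
    (EisensteinPrimesMazurMCOnCellBTwistbackUnitEndP5Cell2090n1.cellB_2090n1_of_analyticRank hr) ⟨_, inferInstance, inferInstance, WeierstrassCurve.isIsogenous_self _, hunit⟩

/-! ## `(2715c1, 5)` — a Ш-unit vertex (`#Ш_an(2715c1) = 1`) -/

/-- **6⁷'s LEFT disjunct at `(2715c1, 5)` AT DISTANCE 0** (the registered stub's «connected Ш-unit class» hypothesis VERBATIM):
`W₁ = W₃ = Wc = W`, the trivial zig-zag (`Relation.ReflTransGen.refl`), the identity isogenies, ONE reading `hunit` (`#Ш_an(2715c1) = 1`,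
Cremona). Fact-free. [cite: CremonaAlgorithms1997, Table 1] -/
theorem connectedClassShaUnit_2715c1_refl
    (W : WeierstrassCurve ℚ) [W.IsElliptic] [W.IsGloballyMinimal]
    (hunit : ∃ q : ℚ, shaAn W = (q : ℂ) ∧ padicValRat 5 q = 0) :
    ∃ (W₁ : WeierstrassCurve ℚ) (_ : W₁.IsElliptic) (_ : W₁.IsGloballyMinimal)
      (W₃ : WeierstrassCurve ℚ) (_ : W₃.IsElliptic) (_ : W₃.IsGloballyMinimal)
      (Wc : WeierstrassCurve ℚ) (_ : Wc.IsElliptic) (_ : Wc.IsGloballyMinimal),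
      IsIsogenous W W₁ ∧
      Relation.ReflTransGen (fun A B : WeierstrassCurve ℚ ↦ TwoStepAt 5 A B ∨
        (TwoStepAt 5 B A ∧ ∃ (_ : B.IsElliptic) (_ : B.IsGloballyMinimal), X2.CellB B 5)) W₁ W₃ ∧
      IsIsogenous W₃ Wc ∧
      ∃ q : ℚ, shaAn Wc = (q : ℂ) ∧ padicValRat 5 q = 0 :=
  ⟨W, inferInstance, inferInstance, W, inferInstance, inferInstance, W, inferInstance, inferInstance,
    WeierstrassCurve.isIsogenous_self W, Relation.ReflTransGen.refl, WeierstrassCurve.isIsogenous_self W, hunit⟩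

/-- **Mazur's main conjecture at `(2715c1, 5)` from PUBLISHED inputs only + two Cremona readings** (`hr`: `r_an = 0`, `L(E,1) = 1.72276310`;
`hunit`: `#Ш_an = 1`, `#T = 5`, `∏c = 25`, `Ω = 1.72276310`): `X2.CellB` in the kernel (p695762's `cellB_2715c1_of_analyticRank`), the class's
own unit member (identity isogeny), `…OfNamedFactsV9.mazurMainConjectureAt_of_namedFacts_of_classShaUnit` (Wuthrich Prop. 21 + GZK,
Cassels, `X2.mazurMainConjectureAt_of_bsdp_of_red`). Cone: `PublishedInputs`, `sha_dvd_analyticSha` — both PUBLISHED. CONDITIONAL;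
nothing booked. [cite: Wuthrich2014, Prop. 21 (p. 400) and Thm. 16 (p. 397)] [cite: MilneADT2006, Thm. I.7.3] [cite: Miller2011LMS, Def. 1.1] -/
theorem mazurMainConjectureAt_2715c1_at_five_of_shaUnit (hP : EisensteinPrimes.PublishedInputs) (hW21 : sha_dvd_analyticSha)
    (W : WeierstrassCurve ℚ) [W.IsElliptic] [W.IsGloballyMinimal] (hW : W = ⟨0, 1, 1, -140, 806⟩) (hr : W.analyticRank = 0)
    (hunit : ∃ q : ℚ, shaAn W = (q : ℂ) ∧ padicValRat 5 q = 0) : X2.MazurMainConjectureAt W 5 := by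
  subst hW
  exact EisensteinPrimesMazurMCOnCellBOfNamedFactsV9.mazurMainConjectureAt_of_namedFacts_of_classShaUnit hP hW21 _ 5
    (EisensteinPrimesMazurMCOnCellBTwistbackUnitEndP5Cell2715c1.cellB_2715c1_of_analyticRank hr)
    ⟨_, inferInstance, inferInstance, WeierstrassCurve.isIsogenous_self _, hunit⟩

/-- **`BSD(E, 5)` at `2715c1` from PUBLISHED inputs only + the same two readings** (w3 g14's `…DefectSwapUp.bsdp_of_cellB_of_classShaUnit`:
Wuthrich Prop. 21 + GZK at the unit member, Cassels). CONDITIONAL; nothing booked.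
[cite: Wuthrich2014, Prop. 21 (p. 400)] [cite: MilneADT2006, Thm. I.7.3] [cite: Miller2011LMS, Def. 1.1] -/
theorem bsdp_2715c1_at_five_of_shaUnit (hP : EisensteinPrimes.PublishedInputs) (hW21 : sha_dvd_analyticSha)
    (W : WeierstrassCurve ℚ) [W.IsElliptic] [W.IsGloballyMinimal] (hW : W = ⟨0, 1, 1, -140, 806⟩) (hr : W.analyticRank = 0)
    (hunit : ∃ q : ℚ, shaAn W = (q : ℂ) ∧ padicValRat 5 q = 0) : BSDp W 5 := by
  subst hW
  exact EisensteinPrimesMazurMCOnCellBTwistbackDefectSwapUp.bsdp_of_cellB_of_classShaUnit hP hW21 _ 5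
    (EisensteinPrimesMazurMCOnCellBTwistbackUnitEndP5Cell2715c1.cellB_2715c1_of_analyticRank hr) ⟨_, inferInstance, inferInstance, WeierstrassCurve.isIsogenous_self _, hunit⟩

end Summit.BirchSwinnertonDyer.BirchSwinnertonDyer.Theorems.EisensteinPrimesMazurMCOnCellBTwistbackShaUnitVertexDisplays01
end
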